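import Literature.AlgebraicGeometry.ShimuraVarieties.KudlaRapoport2013.Sec7to10EisensteinSide
import Literature.NumberTheory.QuadraticForms.HilbertSymbolAtUnramifiedPlace
import Literature.NumberTheory.QuadraticForms.HilbertSymbolBilinear
import Literature.NumberTheory.QuadraticForms.HasseMinkowskiTernaryLemmas
import Literature.NumberTheory.QuadraticForms.HilbertSymbolArchimedean
import Literature.NumberTheory.QuadraticForms.HilbertSymbolRatOdd
import Literature.NumberTheory.QuadraticFields.RingClassNumberFormula
import Mathlib.NumberTheory.NumberField.Discriminant.Different
import Mathlib.NumberTheory.RamificationInertia.Unramified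
import Mathlib.NumberTheory.Padics.HeightOneSpectrum
import Mathlib.NumberTheory.Padics.RingHoms
import Mathlib.RingTheory.Flat.Basic
import HarnessLib

/-!
# [KudlaRapoport2013, §9 (9.2) (arXiv v2 p. 33)] the local character `χ_p` IS the Hilbert symbol `( · , Δ)_p`;
# at an inert `p`, `χ_p(a) = (−1)^{ord_p a}` and `p ∈ Diff(T, V) ⟺ ord_p(det T · det V)` is odd

Kernel-lane THEOREMS (no definition, no named fact, no `sorry`, no instance, no notation) about the REAL vocabulary of the
statement carpet ★ `Literature/AlgebraicGeometry/ShimuraVarieties/KudlaRapoport2013/Sec7to10EisensteinSide.lean` (★ `IsLocalNormAt`,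
★ `diff`), bridging it to the tree's Hilbert-symbol library `Literature/NumberTheory/QuadraticForms/` (O'Meara §63):

* `isLocalNormAt_iff_hilbertSymbol` — for `k = ℚ(θ)`, `θ² = D`, `σ(θ) = −θ`, and `c ∈ ℚ^×`: `χ_p(c) = 1 ⟺ (c, D)_{ℚ_p} = 1`
  (`ℚ_p ⊗ k = ℚ_p ⊗ 1 ⊕ ℚ_p ⊗ θ`, `(x ⊗ 1 + y ⊗ θ)(1 ⊗ σ)(x ⊗ 1 + y ⊗ θ) = (x² − D y²) ⊗ 1`, O'Meara 63:10 = the tree's ★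
  `hilbertSymbol_eq_one_iff_exists_norm`); `isLocalNormAt_iff_hilbertSymbol_adicCompletion` — the same at the place `v ↔ p` of
  `ℚ` (Mathlib `Rat.HeightOneSpectrum.adicCompletion.padicEquiv`);
* `exists_mul_self_eq_discr` — `k = ℚ(√Δ)`: some `θ ∈ k` has `θ² = Δ = d_k` and `σ(θ) = −θ` (KR p. 6 «`k = ℚ(√Δ)`»);
* `not_isSquare_discr_padic_of_isInertPrime` — at an inert `p`, `Δ` is not a square in `ℚ_p` (decomposition law, the tree's ★
  `Quadratic.isPrime_span_natCast_iff_jacobiSym_eq_neg_one` ∕ ★ `isPrime_span_two_iff`);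
* `isLocalNormAt_iff_even_padicValRat` — **at an inert `p`, `χ_p(c) = (−1)^{ord_p c}`** (O'Meara Example 63:16, the tree's ★
  `hilbertSymbol_eq_neg_one_iff_of_isUnramifiedIn`, dyadic `p` included);
* `mem_diff_iff_hilbertSymbol_eq_neg_one`, `mem_diff_iff_odd_padicValRat` — for hermitian `T`, `J` with (rational) determinants
  `d_T`, `d_J ≠ 0`: `p ∈ Diff(T, V) ⟺ (d_T d_J, D)_p = −1` (bimultiplicativity, the tree's ★ `hilbertSymbol_adicCompletion_mul_left`),
  and at an inert `p`: `⟺ ord_p(d_T d_J)` is odd.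

Cell hodgecm-mathlib, seat B-typ01 (g32); inputs of the discharge of ★ `KR2013_9_diff_inert_iff_diff0`.

## References
* [KudlaRapoport2013] S. Kudla, M. Rapoport, *Special cycles on unitary Shimura varieties II: global theory*, J. reine angew.
  Math. 697 (2014) 91–157; arXiv:0912.3758v2, §1 Notation (p. 6), §9 (9.2) (p. 33).
* [Omeara1963] O. T. O'Meara, *Introduction to quadratic forms* (1963), §63B (63:10), §63C Example 63:16.
* [Cox2013] D. A. Cox, *Primes of the form x² + ny²*, 2nd ed. (2013), §5.B Prop. 5.16 (decomposition law in quadratic fields).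
-/

set_option autoImplicit false

noncomputable section

open NumberField IsDedekindDomain Module
open Literature.NumberTheory.Automorphic.Liu2021.AppendixC (conj conj_ne_one conj_apply complexEmbedding_conj)
open Literature.AlgebraicGeometry.ShimuraVarieties.KudlaRapoport2013.Sec2Defs (IsInertPrime)
open Literature.AlgebraicGeometry.ShimuraVarieties.KudlaRapoport2013.Sec3ComplexUniformization (IsHermitianFor)
open Literature.NumberTheory.QuadraticForms
open Literature.NumberTheory.QuadraticFields.Quadratic (exists_basis_zero_eq_one basis_one_mul_self_eq discr_eq_sq_add_four_mul)
open Literature.NumberTheory.QuadraticFields.RingClass (isPrime_span_natCast_iff_jacobiSym_eq_neg_one isPrime_span_two_iff)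
open scoped TensorProduct Matrix

namespace Literature.AlgebraicGeometry.ShimuraVarieties.KudlaRapoport2013.Sec7to10EisensteinSide

variable (k : Type) [Field k] [NumberField k] [IsTotallyComplex k] [Algebra.IsQuadraticExtension ℚ k]

/-! ### `σ`-fixed elements are rational; `k = ℚ ⊕ ℚ θ` -/

/-- An element fixed by `σ` (= complex conjugation of the CM field `k`, Mathlib `IsCMField.complexConj`) is rational: the fixed
field of `σ` is the maximal real subfield `k⁺ = ℚ`. [folklore] -/
private theorem exists_rat_eq_of_conj_eq {x : k} (hx : conj ℚ k x = x) : ∃ q : ℚ, algebraMap ℚ k q = x := by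
  letI : IsCMField k := IsCMField.ofCMExtension ℚ k
  have hx' : IsCMField.complexConj k x = x := hx
  have hmem : x ∈ maximalRealSubfield k := (IsCMField.complexConj_eq_self_iff (K := k) x).1 hx'
  exact ⟨(CMExtension.equivMaximalRealSubfield ℚ k).symm ⟨x, hmem⟩, by
    rw [CMExtension.algebraMap_equivMaximalRealSubfield_symm_apply]; rfl⟩

/-- `σ` is an involution. [folklore] -/
private theorem conj_conj (x : k) : conj ℚ k (conj ℚ k x) = x := by
  letI : IsCMField k := IsCMField.ofCMExtension ℚ k
  exact IsCMField.complexConj_apply_apply (K := k) x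

variable {k} in
/-- Every `y ∈ k` is `a + b θ` with `a, b ∈ ℚ`, for any `θ ≠ 0` with `σ(θ) = −θ` (`a = (y + σy)/2`, `bθ = (y − σy)/2`).
[folklore] -/
private theorem exists_rat_add_rat_mul {θ : k} (hθ0 : θ ≠ 0) (hθσ : conj ℚ k θ = -θ) (y : k) :
    ∃ a b : ℚ, y = algebraMap ℚ k a + algebraMap ℚ k b * θ := by
  obtain ⟨a, ha⟩ := exists_rat_eq_of_conj_eq k (x := (y + conj ℚ k y) / 2)
    (by rw [map_div₀, map_add, conj_conj, map_ofNat, add_comm])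
  obtain ⟨b, hb⟩ := exists_rat_eq_of_conj_eq k (x := (y - conj ℚ k y) / (2 * θ))
    (by rw [map_div₀, map_sub, map_mul, conj_conj, map_ofNat, hθσ]; field_simp; ring)
  refine ⟨a, b, ?_⟩
  rw [ha, hb]
  field_simp
  ring

/-! ### `χ_p` is the Hilbert symbol `( · , D)_p` -/

section Local

variable {k}
variable {θ : k} {D : ℚ} (hθ0 : θ ≠ 0) (hθ : θ * θ = algebraMap ℚ k D) (hθσ : conj ℚ k θ = -θ)
variable {p : ℕ} [Fact p.Prime]

include hθ hθσ in
/-- `(x ⊗ 1 + y ⊗ θ) · (1 ⊗ σ)(x ⊗ 1 + y ⊗ θ) = (x² − D y²) ⊗ 1` in `ℚ_p ⊗ k`. [folklore] -/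
private theorem norm_tmul_eq (x y : ℚ_[p]) :
    (x ⊗ₜ[ℚ] (1 : k) + y ⊗ₜ[ℚ] θ) *
        Algebra.TensorProduct.map (AlgHom.id ℚ ℚ_[p]) (conj ℚ k : k →ₐ[ℚ] k) (x ⊗ₜ[ℚ] (1 : k) + y ⊗ₜ[ℚ] θ) =
      (x * x - D • (y * y)) ⊗ₜ[ℚ] (1 : k) := by
  have hc1 : (conj ℚ k : k →ₐ[ℚ] k) 1 = 1 := map_one _
  have hcθ : (conj ℚ k : k →ₐ[ℚ] k) θ = -θ := hθσ
  rw [map_add, Algebra.TensorProduct.map_tmul, Algebra.TensorProduct.map_tmul, AlgHom.id_apply, AlgHom.id_apply, hc1,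
    hcθ, TensorProduct.tmul_neg]
  have hDk : algebraMap ℚ k D = D • (1 : k) := Algebra.algebraMap_eq_smul_one D
  calc (x ⊗ₜ[ℚ] (1 : k) + y ⊗ₜ[ℚ] θ) * (x ⊗ₜ[ℚ] (1 : k) + -(y ⊗ₜ[ℚ] θ))
      = x ⊗ₜ[ℚ] (1 : k) * (x ⊗ₜ[ℚ] (1 : k)) - y ⊗ₜ[ℚ] θ * (y ⊗ₜ[ℚ] θ) := by ring
    _ = (x * x) ⊗ₜ[ℚ] (1 : k) - (y * y) ⊗ₜ[ℚ] (θ * θ) := by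
        rw [Algebra.TensorProduct.tmul_mul_tmul, Algebra.TensorProduct.tmul_mul_tmul, mul_one]
    _ = (x * x) ⊗ₜ[ℚ] (1 : k) - (D • (y * y)) ⊗ₜ[ℚ] (1 : k) := by
        rw [hθ, hDk, TensorProduct.tmul_smul, TensorProduct.smul_tmul']
    _ = (x * x - D • (y * y)) ⊗ₜ[ℚ] (1 : k) := by rw [← TensorProduct.sub_tmul]

include hθ0 hθσ in
/-- `ℚ_p ⊗ k = ℚ_p ⊗ 1 + ℚ_p ⊗ θ`. [folklore] -/
private theorem exists_eq_tmul_add_tmul (z : ℚ_[p] ⊗[ℚ] k) : ∃ x y : ℚ_[p], z = x ⊗ₜ[ℚ] (1 : k) + y ⊗ₜ[ℚ] θ := by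
  induction z using TensorProduct.induction_on with
  | zero => exact ⟨0, 0, by simp⟩
  | tmul a w =>
      obtain ⟨α, β, hw⟩ := exists_rat_add_rat_mul hθ0 hθσ w
      refine ⟨α • a, β • a, ?_⟩
      rw [hw, TensorProduct.tmul_add, Algebra.algebraMap_eq_smul_one, TensorProduct.tmul_smul, TensorProduct.smul_tmul',
        ← Algebra.smul_def, TensorProduct.tmul_smul, TensorProduct.smul_tmul']
  | add u w hu hw =>
      obtain ⟨x₁, y₁, rfl⟩ := hu
      obtain ⟨x₂, y₂, rfl⟩ := hw
      exact ⟨x₁ + x₂, y₁ + y₂, by rw [TensorProduct.add_tmul, TensorProduct.add_tmul]; abel⟩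

include hθ0 hθ hθσ in
/-- `χ_p(c) = 1 ⟺ c = x² − D y²` in `ℚ_p`. [folklore] -/
private theorem isLocalNormAt_iff_exists (c : ℚ) :
    IsLocalNormAt k p c ↔ ∃ x y : ℚ_[p], x * x - D • (y * y) = algebraMap ℚ ℚ_[p] c := by
  constructor
  · rintro ⟨z, hz⟩
    obtain ⟨x, y, rfl⟩ := exists_eq_tmul_add_tmul hθ0 hθσ z
    rw [norm_tmul_eq hθ hθσ] at hz
    exact ⟨x, y, Algebra.TensorProduct.includeLeft_injective (R := ℚ) (S := ℚ) (A := ℚ_[p]) (B := k)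
      (algebraMap ℚ k).injective hz⟩
  · rintro ⟨x, y, h⟩
    exact ⟨x ⊗ₜ[ℚ] (1 : k) + y ⊗ₜ[ℚ] θ, by rw [norm_tmul_eq hθ hθσ, h]⟩

include hθ0 hθ hθσ in
/-- **`χ_p` is the Hilbert symbol** ([KR2013] (9.2) «`χ_p(a) = 1`» = `a` is a norm from `k_p = ℚ_p ⊗ k`): for `k = ℚ(θ)` with
`θ² = D`, `σ(θ) = −θ`, `θ ≠ 0`, `D ≠ 0` and `c ∈ ℚ^×`, `χ_p(c) = 1 ⟺ (c, D)_{ℚ_p} = 1` — O'Meara 63:10 «`(α, β)_𝔭 = 1` iff `α ∈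
N_{E/F}(E)`, `E = F(√β)`». [cite: Omeara1963, §63B (63:10)] [cite: KudlaRapoport2013, §9 (9.2) (arXiv v2 p. 33)] -/
theorem isLocalNormAt_iff_hilbertSymbol (hD0 : D ≠ 0) {c : ℚ} (hc : c ≠ 0) :
    IsLocalNormAt k p c ↔ hilbertSymbol ℚ_[p] (algebraMap ℚ ℚ_[p] c) (algebraMap ℚ ℚ_[p] D) = 1 := by
  rw [hilbertSymbol_comm, hilbertSymbol_eq_one_iff_exists_norm ((map_ne_zero _).2 hD0) ((map_ne_zero _).2 hc),
    isLocalNormAt_iff_exists hθ0 hθ hθσ]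
  simp only [sq, Algebra.smul_def]

/-- The Hilbert symbol of two rationals at the finite place `v` of `ℚ`, computed in `ℚ_v` or in `ℚ_p` (`p = p_v`, Mathlib
`adicCompletion.padicEquiv`). [folklore] -/
private theorem hilbertSymbol_adicCompletion_eq_padic (v : HeightOneSpectrum (𝓞 ℚ))
    [Fact (Rat.HeightOneSpectrum.primesEquiv (R := 𝓞 ℚ) v : ℕ).Prime] (a b : ℚ) :
    hilbertSymbol (v.adicCompletion ℚ) (algebraMap ℚ _ a) (algebraMap ℚ _ b) =
      hilbertSymbol ℚ_[Rat.HeightOneSpectrum.primesEquiv (R := 𝓞 ℚ) v] (algebraMap ℚ _ a) (algebraMap ℚ _ b) := by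
  let e := (Rat.HeightOneSpectrum.adicCompletion.padicEquiv (R := 𝓞 ℚ) v).toAlgEquiv
  rw [← hilbertSymbol_map_ringEquiv e.toRingEquiv]
  have hea : ∀ q : ℚ, e.toRingEquiv (algebraMap ℚ (v.adicCompletion ℚ) q) =
      algebraMap ℚ ℚ_[Rat.HeightOneSpectrum.primesEquiv (R := 𝓞 ℚ) v] q := fun q => by
    change e (algebraMap ℚ (v.adicCompletion ℚ) q) = _
    rw [AlgEquiv.commutes]
  rw [hea, hea]

include hθ0 hθ hθσ in
/-- **`χ_{p_v}(c) = 1 ⟺ (c, D)_v = 1`** in the completion `ℚ_v` of `ℚ` at the finite place `v` over `p_v` (the form in which the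
tree's Hilbert-symbol library is stated). [cite: Omeara1963, §63B (63:10)] [cite: KudlaRapoport2013, §9 (9.2) (arXiv v2 p. 33)] -/
theorem isLocalNormAt_iff_hilbertSymbol_adicCompletion (hD0 : D ≠ 0) (v : HeightOneSpectrum (𝓞 ℚ))
    [Fact (Rat.HeightOneSpectrum.primesEquiv (R := 𝓞 ℚ) v : ℕ).Prime] {c : ℚ} (hc : c ≠ 0) :
    IsLocalNormAt k (Rat.HeightOneSpectrum.primesEquiv (R := 𝓞 ℚ) v : ℕ) c ↔
      hilbertSymbol (v.adicCompletion ℚ) (algebraMap ℚ _ c) (algebraMap ℚ _ D) = 1 := by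
  rw [isLocalNormAt_iff_hilbertSymbol hθ0 hθ hθσ hD0 hc, hilbertSymbol_adicCompletion_eq_padic]

end Local

/-! ### `p ∈ Diff(T, V) ⟺ (det T · det V, D)_p = −1` -/

/-- `±1`-valued bookkeeping: `¬ (s = 1 ↔ t = 1)` iff `s t = −1`. [folklore] -/
private theorem not_iff_iff_mul_eq_neg_one {s t : ℤ} (hs : s = 1 ∨ s = -1) (ht : t = 1 ∨ t = -1) :
    ¬ (s = 1 ↔ t = 1) ↔ s * t = -1 := by
  rcases hs with rfl | rfl <;> rcases ht with rfl | rfl <;> decide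

section Places

variable {k}
variable {θ : k} {D : ℚ} (hθ0 : θ ≠ 0) (hθ : θ * θ = algebraMap ℚ k D) (hθσ : conj ℚ k θ = -θ) (hD0 : D ≠ 0)
variable {n : ℕ} {T J : Matrix (Fin n) (Fin n) k} {dT dJ : ℚ}
  (hdT : algebraMap ℚ k dT = T.det) (hdJ : algebraMap ℚ k dJ = J.det) (hdT0 : dT ≠ 0) (hdJ0 : dJ ≠ 0)

include hθ0 hθ hθσ hD0 hdT hdJ hdT0 hdJ0 in
/-- **`p ∈ Diff(T, V) ⟺ (det T · det V, D)_p = −1`** at the finite place `v ↔ p` of `ℚ`, for `T`, `J` with rational determinants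
`d_T`, `d_J ≠ 0` (so that the quantifiers of ★ `diff` bind them): `χ_p(d_T) ≠ χ_p(d_J)` iff `(d_T, D)_p (d_J, D)_p = −1`
(bimultiplicativity of the local symbol, O'Meara §63B). [cite: KudlaRapoport2013, §9 (9.2) (arXiv v2 p. 33)]
[cite: Omeara1963, §63B (formulas after 63:10)] -/
theorem mem_diff_iff_hilbertSymbol_eq_neg_one (v : HeightOneSpectrum (𝓞 ℚ)) :
    (Rat.HeightOneSpectrum.primesEquiv (R := 𝓞 ℚ) v : ℕ) ∈ diff k T J ↔
      hilbertSymbol (v.adicCompletion ℚ) (algebraMap ℚ _ (dT * dJ)) (algebraMap ℚ _ D) = -1 := by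
  haveI hp : Fact (Rat.HeightOneSpectrum.primesEquiv (R := 𝓞 ℚ) v : ℕ).Prime := ⟨(Rat.HeightOneSpectrum.primesEquiv v).2⟩
  have key : ∀ c : ℚ, c ≠ 0 → (IsLocalNormAt k (Rat.HeightOneSpectrum.primesEquiv (R := 𝓞 ℚ) v : ℕ) c ↔
      hilbertSymbol (v.adicCompletion ℚ) (algebraMap ℚ _ c) (algebraMap ℚ _ D) = 1) := fun c hc =>
    isLocalNormAt_iff_hilbertSymbol_adicCompletion hθ0 hθ hθσ hD0 v hc
  have hne : ∀ {c : ℚ}, c ≠ 0 → (algebraMap ℚ (v.adicCompletion ℚ) c) ≠ 0 := fun hc => (map_ne_zero _).2 hc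
  have hmul : hilbertSymbol (v.adicCompletion ℚ) (algebraMap ℚ _ (dT * dJ)) (algebraMap ℚ _ D) =
      hilbertSymbol (v.adicCompletion ℚ) (algebraMap ℚ _ dT) (algebraMap ℚ _ D) *
        hilbertSymbol (v.adicCompletion ℚ) (algebraMap ℚ _ dJ) (algebraMap ℚ _ D) := by
    rw [map_mul, hilbertSymbol_adicCompletion_mul_left ℚ v (hne hdT0) (hne hdJ0) (hne hD0)]
  have hiff : (Rat.HeightOneSpectrum.primesEquiv (R := 𝓞 ℚ) v : ℕ) ∈ diff k T J ↔
      ¬ (IsLocalNormAt k (Rat.HeightOneSpectrum.primesEquiv (R := 𝓞 ℚ) v : ℕ) dT ↔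
          IsLocalNormAt k (Rat.HeightOneSpectrum.primesEquiv (R := 𝓞 ℚ) v : ℕ) dJ) := by
    constructor
    · rintro ⟨_, h⟩
      exact h dT dJ hdT hdJ
    · intro h
      refine ⟨hp, fun dT' dJ' h1 h2 => ?_⟩
      obtain rfl : dT' = dT := (algebraMap ℚ k).injective (h1.trans hdT.symm)
      obtain rfl : dJ' = dJ := (algebraMap ℚ k).injective (h2.trans hdJ.symm)
      exact h
  rw [hiff, key dT hdT0, key dJ hdJ0,
    not_iff_iff_mul_eq_neg_one (hilbertSymbol_eq_one_or_eq_neg_one _ _) (hilbertSymbol_eq_one_or_eq_neg_one _ _), hmul]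

end Places

/-! ### `k = ℚ(√Δ)`: a square root of the discriminant moved by `σ` -/

/-- **`k = ℚ(√Δ)`** ([KR2013] p. 6: «`k = ℚ(√Δ)` an imaginary quadratic field with discriminant `Δ`»): there is `θ ∈ k` with
`θ² = Δ = d_k` and `σ(θ) = −θ` — for an integral basis `(1, ω)`, `ω² = m + tω`, take `θ = 2ω − t`; `σ(ω) = t − ω` since
`σ(ω)` is the other root of `X² − tX − m` (`σ(ω) = ω` would force `σ = 1` on `k = ℚ ⊕ ℚω`).
[cite: KudlaRapoport2013, §1 Notation (arXiv v2 p. 6)] -/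
theorem exists_mul_self_eq_discr :
    ∃ θ : k, θ * θ = algebraMap ℚ k (NumberField.discr k : ℚ) ∧ conj ℚ k θ = -θ := by
  have h2 : finrank ℚ k = 2 := Algebra.IsQuadraticExtension.finrank_eq_two (R := ℚ) (S := k)
  obtain ⟨b, hb⟩ := exists_basis_zero_eq_one (K := k) h2
  set ω : 𝓞 k := b 1 with hω
  set m : ℤ := b.repr (ω * ω) 0 with hm
  set t : ℤ := b.repr (ω * ω) 1 with ht
  have hωω : (ω : k) * ω = (m : k) + (t : k) * ω := by
    have h := congrArg (fun w : 𝓞 k => (w : k)) (basis_one_mul_self_eq b hb)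
    simpa using h
  have hΔ : NumberField.discr k = t ^ 2 + 4 * m := discr_eq_sq_add_four_mul b hb
  have hσω : conj ℚ k (ω : k) = (t : k) - ω := by
    set s := conj ℚ k (ω : k) with hs
    have hss : s * s = (m : k) + (t : k) * s := by
      have h := congrArg (conj ℚ k) hωω
      simpa [map_mul, map_add, map_intCast] using h
    have hprod : (s - ω) * (s - ((t : k) - ω)) = 0 := by linear_combination hss - hωω
    rcases mul_eq_zero.mp hprod with h | h
    · exfalso
      apply conj_ne_one ℚ k
      have hsω : conj ℚ k (ω : k) = ω := sub_eq_zero.mp h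
      let B : Basis (Fin 2) ℚ k := b.localizationLocalization ℚ (nonZeroDivisors ℤ) k
      have hB0 : B 0 = 1 := by simp [B, hb]
      have hB1 : B 1 = (ω : k) := by simp [B, hω]
      refine AlgEquiv.ext fun u => ?_
      have hu := B.sum_repr u
      rw [Fin.sum_univ_two, hB0, hB1, Rat.smul_one_eq_cast, Rat.smul_def] at hu
      rw [← hu, map_add, map_mul, map_ratCast, map_ratCast, hsω, AlgEquiv.one_apply]
    · exact sub_eq_zero.mp h
  refine ⟨2 * (ω : k) - t, ?_, ?_⟩
  · rw [map_intCast, hΔ]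
    push_cast
    linear_combination (4 : k) * hωω
  · rw [map_sub, map_mul, map_ofNat, map_intCast, hσω]
    ring

/-- A square root of the discriminant is non-zero and not rational. [folklore] -/
private theorem ne_zero_and_forall_ne_of_mul_self_eq_discr {θ : k}
    (hθ : θ * θ = algebraMap ℚ k (NumberField.discr k : ℚ)) (hθσ : conj ℚ k θ = -θ) :
    θ ≠ 0 ∧ ∀ r : ℚ, algebraMap ℚ k r ≠ θ := by
  have hθ0 : θ ≠ 0 := by
    intro h0
    rw [h0, mul_zero, map_intCast] at hθ
    exact NumberField.discr_ne_zero k (by exact_mod_cast hθ.symm)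
  refine ⟨hθ0, fun r hr => hθ0 ?_⟩
  have h1 : conj ℚ k θ = θ := by rw [← hr, AlgEquiv.commutes]
  rw [hθσ] at h1
  have h2 : (2 : k) * θ = 0 := by linear_combination -h1
  exact (mul_eq_zero.1 h2).resolve_left two_ne_zero

/-! ### At an inert `p`, `Δ` is not a square in `ℚ_p` -/

/-- Squares in `ℤ/8` are `0, 1, 4`: none is `5`. [folklore] -/
private theorem zmod8_sq_ne_five : ∀ x : ZMod 8, x ^ 2 ≠ 5 := by decide

omit [IsTotallyComplex k] in
/-- **At an inert prime `Δ` is a non-square in `ℚ_p`**: a `p`-adic square root of `Δ` would be a `p`-adic unit square root, so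
`Δ` would be a non-zero square mod `p` (`p` odd), resp. `Δ ≡ 1 (mod 8)` (`p = 2`), whereas `p` inert means `(Δ/p) = −1`, resp.
`Δ ≡ 5 (mod 8)` (the decomposition law, the tree's ★ `isPrime_span_natCast_iff_jacobiSym_eq_neg_one` ∕ ★ `isPrime_span_two_iff`).
[cite: Cox2013, §5.B Prop. 5.16, p. 105] -/
theorem not_isSquare_discr_padic_of_isInertPrime {p : ℕ} [hp : Fact p.Prime] (hin : IsInertPrime k p) :
    ¬ IsSquare ((NumberField.discr k : ℚ_[p])) := by
  have h2 : finrank ℚ k = 2 := Algebra.IsQuadraticExtension.finrank_eq_two (R := ℚ) (S := k)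
  obtain ⟨_, hndvd, hprime⟩ := hin
  rintro ⟨z, hz⟩
  -- `z` is a `p`-adic integer with `Z² = Δ` in `ℤ_p`
  have hz1 : ‖z‖ ≤ 1 := by
    have h : ‖z‖ * ‖z‖ ≤ 1 := by rw [← norm_mul, ← hz]; exact Padic.norm_int_le_one _
    nlinarith [norm_nonneg z]
  set Z : ℤ_[p] := ⟨z, hz1⟩ with hZ
  have hZZ : ((NumberField.discr k : ℤ) : ℤ_[p]) = Z * Z := by
    apply Subtype.ext
    rw [PadicInt.coe_intCast, PadicInt.coe_mul]
    exact hz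
  have hΔ0 : ¬ (p : ℤ) ∣ NumberField.discr k := fun h => hndvd (Int.natCast_dvd.1 h)
  by_cases hp2 : p = 2
  · -- dyadic: `Δ ≡ Z² ≡ 1 (mod 8)` contradicts `Δ ≡ 5 (mod 8)`
    subst hp2
    have h5 : NumberField.discr k % 8 = 5 := (isPrime_span_two_iff (K := k) h2).1 hprime
    have hmod : ((NumberField.discr k : ℤ) : ZMod (2 ^ 3)) = PadicInt.toZModPow 3 Z ^ 2 := by
      rw [← map_intCast (PadicInt.toZModPow 3), hZZ, map_mul, sq]
    have hcast : ((NumberField.discr k : ℤ) : ZMod (2 ^ 3)) = 5 := by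
      have h8 : ((NumberField.discr k % 8 : ℤ) : ZMod 8) = (NumberField.discr k : ZMod 8) := ZMod.intCast_mod _ 8
      rw [h5] at h8
      exact_mod_cast h8.symm
    exact zmod8_sq_ne_five (PadicInt.toZModPow 3 Z) (by rw [← hmod]; exact_mod_cast hcast)
  · -- odd `p`: `Δ` is a non-zero square mod `p`, so `(Δ/p) = 1`, contradicting inertness `(Δ/p) = −1`
    have hmod : ((NumberField.discr k : ℤ) : ZMod p) = PadicInt.toZMod Z ^ 2 := by
      rw [← map_intCast (PadicInt.toZMod (p := p)), hZZ, map_mul, sq]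
    have hne0 : ((NumberField.discr k : ℤ) : ZMod p) ≠ 0 := by
      rwa [Ne, ZMod.intCast_zmod_eq_zero_iff_dvd]
    have hsq : IsSquare ((NumberField.discr k : ℤ) : ZMod p) := ⟨PadicInt.toZMod Z, by rw [hmod, sq]⟩
    have hleg : legendreSym p (NumberField.discr k) = 1 := (legendreSym.eq_one_iff p hne0).2 hsq
    have hjac : jacobiSym (NumberField.discr k) p = -1 :=
      (isPrime_span_natCast_iff_jacobiSym_eq_neg_one (K := k) h2 hp.out hp2).1 hprime
    rw [← jacobiSym.legendreSym.to_jacobiSym, hleg] at hjac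
    norm_num at hjac

/-! ### The place `v ↔ p` of `ℚ`: `log |c|_v = −ord_p(c)`, and unramifiedness from `p ∤ Δ` -/

/-- `p_v = natGenerator v` (Mathlib `Rat.HeightOneSpectrum.primesEquiv`, by definition). [folklore] -/
private theorem coe_primesEquiv (v : HeightOneSpectrum (𝓞 ℚ)) :
    (Rat.HeightOneSpectrum.primesEquiv (R := 𝓞 ℚ) v : ℕ) = Rat.HeightOneSpectrum.natGenerator v := rfl

/-- `|p|_v = exp(−1)` for the prime `p` under `v` (the tree's ★ `RatPlace.intValuation_natGenerator`). [folklore] -/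
private theorem valuation_natGenerator (v : HeightOneSpectrum (𝓞 ℚ)) :
    v.valuation ℚ ((Rat.HeightOneSpectrum.natGenerator v : ℕ) : ℚ) = WithZero.exp (-1 : ℤ) := by
  rw [show ((Rat.HeightOneSpectrum.natGenerator v : ℕ) : ℚ) =
      algebraMap (𝓞 ℚ) ℚ ((Rat.HeightOneSpectrum.natGenerator v : ℕ) : 𝓞 ℚ) by rw [map_natCast],
    HeightOneSpectrum.valuation_of_algebraMap]
  exact RatPlace.intValuation_natGenerator v

/-- **`|x|_v = exp(−ord_p x)`** for `x ∈ ℚ^×` (Mathlib proves the `v`-adic and the `p`-adic valuations equivalent,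
`valuation_equiv_padicValuation`; both send `p` to `exp(−1)`, hence agree). [folklore] -/
private theorem valuation_eq_exp_neg_padicValRat (v : HeightOneSpectrum (𝓞 ℚ)) {x : ℚ} (hx : x ≠ 0) :
    v.valuation ℚ x = WithZero.exp (-padicValRat (Rat.HeightOneSpectrum.natGenerator v) x) := by
  haveI : Fact (Nat.Prime (Rat.HeightOneSpectrum.primesEquiv (R := 𝓞 ℚ) v : ℕ)) :=
    ⟨(Rat.HeightOneSpectrum.primesEquiv v).2⟩
  have hequiv := Rat.HeightOneSpectrum.valuation_equiv_padicValuation (R := 𝓞 ℚ) v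
  set n : ℤ := padicValRat (Rat.HeightOneSpectrum.natGenerator v) x with hn
  have h2x : Rat.padicValuation (Rat.HeightOneSpectrum.primesEquiv (R := 𝓞 ℚ) v : ℕ) x = WithZero.exp (-n) := by
    simp [Rat.padicValuation, hx, hn, coe_primesEquiv]
  have h2p : Rat.padicValuation (Rat.HeightOneSpectrum.primesEquiv (R := 𝓞 ℚ) v : ℕ)
      (((Rat.HeightOneSpectrum.natGenerator v : ℕ) : ℚ) ^ n) = WithZero.exp (-n) := by
    rw [map_zpow₀, ← coe_primesEquiv, Rat.padicValuation_self, ← WithZero.exp_zsmul]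
    simp
  have h1p : v.valuation ℚ (((Rat.HeightOneSpectrum.natGenerator v : ℕ) : ℚ) ^ n) = WithZero.exp (-n) := by
    rw [map_zpow₀, valuation_natGenerator, ← WithZero.exp_zsmul]
    simp
  rw [← h1p]
  exact (hequiv.eq_iff).mpr (h2x.trans h2p.symm)

/-- `log |x|_v = −ord_p(x)` in the completion `ℚ_v`. [folklore] -/
private theorem log_valued_algebraMap (v : HeightOneSpectrum (𝓞 ℚ)) {x : ℚ} (hx : x ≠ 0) :
    WithZero.log (Valued.v (algebraMap ℚ (v.adicCompletion ℚ) x)) =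
      -padicValRat (Rat.HeightOneSpectrum.natGenerator v) x := by
  have hval : Valued.v (algebraMap ℚ (v.adicCompletion ℚ) x) = v.valuation ℚ x :=
    HeightOneSpectrum.valuedAdicCompletion_eq_valuation' v x
  rw [hval, valuation_eq_exp_neg_padicValRat v hx, WithZero.log_exp]

/-- `p ∈ 𝔭_v` for the prime `p` under `v`. [folklore] -/
private theorem natCast_natGenerator_mem (v : HeightOneSpectrum (𝓞 ℚ)) :
    ((Rat.HeightOneSpectrum.natGenerator v : ℕ) : 𝓞 ℚ) ∈ v.asIdeal := by
  rw [RatPlace.asIdeal_eq_span_natGenerator]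
  exact Ideal.mem_span_singleton_self _

/-- A finite place of `ℚ` containing the prime `p` lies over `(p) ⊆ ℤ`. [folklore] -/
private theorem liesOver_span_of_natCast_mem {p : ℕ} (hp : p.Prime) (v : HeightOneSpectrum (𝓞 ℚ))
    (hv : (p : 𝓞 ℚ) ∈ v.asIdeal) : v.asIdeal.LiesOver (Ideal.span {(p : ℤ)}) := by
  haveI hmax : (Ideal.span {(p : ℤ)}).IsMaximal :=
    ((Ideal.span_singleton_prime (by exact_mod_cast hp.ne_zero)).mpr
      (Nat.prime_iff_prime_int.mp hp)).isMaximal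
        (by rw [ne_eq, Ideal.span_singleton_eq_bot]; exact_mod_cast hp.ne_zero)
  refine ⟨(hmax.eq_of_le (Ideal.comap_ne_top _ v.isPrime.ne_top) ?_)⟩
  rw [Ideal.span_singleton_le_iff_mem, Ideal.mem_comap, map_natCast]
  exact hv

omit [IsTotallyComplex k] [Algebra.IsQuadraticExtension ℚ k] in
/-- **`p ∤ Δ` ⟹ `v_p` is unramified in `k`** (Mathlib `NumberField.not_dvd_discr_iff_isUnramifiedIn` for `(p) ⊆ ℤ`, moved to the
place `v_p` of `𝓞 ℚ` by `e(𝔓|p) = e(v_p|p) e(𝔓|v_p)`, Mathlib `Ideal.ramificationIdx_tower`). [folklore] -/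
private theorem isUnramifiedIn_of_not_dvd_discr {p : ℕ} (hp : p.Prime) (hdisc : ¬ (p : ℤ) ∣ NumberField.discr k)
    (v : HeightOneSpectrum (𝓞 ℚ)) (hv : (p : 𝓞 ℚ) ∈ v.asIdeal) : Algebra.IsUnramifiedIn (𝓞 k) v.asIdeal := by
  have hM : Algebra.IsUnramifiedIn (𝓞 k) (Ideal.span {(p : ℤ)}) :=
    (NumberField.not_dvd_discr_iff_isUnramifiedIn k (𝓞 k) (Nat.prime_iff_prime_int.mp hp)).1 hdisc
  haveI := v.isPrime
  haveI := liesOver_span_of_natCast_mem hp v hv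
  rw [Algebra.isUnramifiedIn_iff_forall_ramificationIdx_eq_one]
  intro Q _ hQ
  haveI := hQ
  haveI : Q.LiesOver (Ideal.span {(p : ℤ)}) := Ideal.LiesOver.trans Q v.asIdeal _
  have h1 := (Algebra.isUnramifiedIn_iff_forall_ramificationIdx_eq_one.mp hM) Q ‹_›
  rw [Ideal.ramificationIdx_tower (R := ℤ) v.asIdeal Q] at h1
  exact Nat.eq_one_of_mul_eq_one_left h1

/-! ### At an inert `p`: `χ_p(c) = (−1)^{ord_p c}` and `p ∈ Diff(T, V) ⟺ ord_p(det T det V)` odd -/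

/-- Squares move along the `ℚ`-algebra isomorphism `ℚ_v ≃ ℚ_p`. [folklore] -/
private theorem isSquare_algebraMap_adicCompletion_iff (v : HeightOneSpectrum (𝓞 ℚ))
    [Fact (Nat.Prime (Rat.HeightOneSpectrum.primesEquiv (R := 𝓞 ℚ) v : ℕ))] (x : ℚ) :
    IsSquare (algebraMap ℚ (v.adicCompletion ℚ) x) ↔
      IsSquare ((x : ℚ_[Rat.HeightOneSpectrum.primesEquiv (R := 𝓞 ℚ) v])) := by
  let e := (Rat.HeightOneSpectrum.adicCompletion.padicEquiv (R := 𝓞 ℚ) v).toAlgEquiv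
  have hea : e (algebraMap ℚ (v.adicCompletion ℚ) x) = (x : ℚ_[Rat.HeightOneSpectrum.primesEquiv (R := 𝓞 ℚ) v]) := by
    rw [AlgEquiv.commutes, eq_ratCast]
  constructor
  · rintro ⟨r, hr⟩
    exact ⟨e r, by rw [← map_mul, ← hr, hea]⟩
  · rintro ⟨r, hr⟩
    refine ⟨e.symm r, e.injective ?_⟩
    rw [map_mul, AlgEquiv.apply_symm_apply, hea, hr]

/-- `χ_p` does not depend on the primality witness ∕ the name of `p`. [folklore] -/
private theorem isLocalNormAt_congr {p q : ℕ} [Fact p.Prime] [Fact q.Prime] (h : p = q) (c : ℚ) :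
    IsLocalNormAt k p c ↔ IsLocalNormAt k q c := by
  subst h
  exact Iff.rfl

/-- **At an inert `p`, `χ_p(c) = (−1)^{ord_p c}`** for `c ∈ ℚ^×`: `k_p/ℚ_p` is the unramified quadratic extension, whose norms
are exactly the elements of even order — O'Meara Example 63:16 «`N_{E/F} Ė = {α ∈ Ḟ : ord_𝔭 α even}`» (the tree's ★
`hilbertSymbol_eq_neg_one_iff_of_isUnramifiedIn`, dyadic `p` included). [cite: Omeara1963, §63C Example 63:16]
[cite: KudlaRapoport2013, §9 (9.2) (arXiv v2 p. 33)] -/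
theorem isLocalNormAt_iff_even_padicValRat {p : ℕ} [hp : Fact p.Prime] (hin : IsInertPrime k p) {c : ℚ} (hc : c ≠ 0) :
    IsLocalNormAt k p c ↔ Even (padicValRat p c) := by
  -- the place `v` of `ℚ` under `p`
  set v : HeightOneSpectrum (𝓞 ℚ) := (Rat.HeightOneSpectrum.primesEquiv (R := 𝓞 ℚ)).symm ⟨p, hp.out⟩ with hv
  have hvp : (Rat.HeightOneSpectrum.primesEquiv (R := 𝓞 ℚ) v : ℕ) = p := by rw [hv, Equiv.apply_symm_apply]
  have hgen : Rat.HeightOneSpectrum.natGenerator v = p := hvp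
  haveI : Fact (Nat.Prime (Rat.HeightOneSpectrum.primesEquiv (R := 𝓞 ℚ) v : ℕ)) := ⟨(Rat.HeightOneSpectrum.primesEquiv v).2⟩
  -- `k = ℚ(θ)`, `θ² = Δ`, `σθ = −θ`
  obtain ⟨θ, hθ, hθσ⟩ := exists_mul_self_eq_discr k
  obtain ⟨hθ0, hθQ⟩ := ne_zero_and_forall_ne_of_mul_self_eq_discr k hθ hθσ
  have hΔ0 : (NumberField.discr k : ℚ) ≠ 0 := by exact_mod_cast NumberField.discr_ne_zero k
  -- unramified and non-square at `v`
  have hunr : Algebra.IsUnramifiedIn (𝓞 k) v.asIdeal :=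
    isUnramifiedIn_of_not_dvd_discr k hp.out (fun h => hin.2.1 (Int.natCast_dvd.1 h)) v
      (hgen ▸ natCast_natGenerator_mem v)
  have hnsq : ¬ IsSquare (algebraMap ℚ (v.adicCompletion ℚ) (NumberField.discr k : ℚ)) := by
    rw [isSquare_algebraMap_adicCompletion_iff]
    have h := not_isSquare_discr_padic_of_isInertPrime k (p := (Rat.HeightOneSpectrum.primesEquiv (R := 𝓞 ℚ) v : ℕ))
      (hvp ▸ hin)
    exact_mod_cast h
  -- `χ_p(c) = 1 ⟺ (c, Δ)_v = 1 ⟺ ord_v(c) even`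
  have h1 : IsLocalNormAt k p c ↔
      hilbertSymbol (v.adicCompletion ℚ) (algebraMap ℚ _ c) (algebraMap ℚ _ (NumberField.discr k : ℚ)) = 1 :=
    (isLocalNormAt_congr k hvp.symm c).trans (isLocalNormAt_iff_hilbertSymbol_adicCompletion hθ0 hθ hθσ hΔ0 v hc)
  have hc' : algebraMap ℚ (v.adicCompletion ℚ) c ≠ 0 := (map_ne_zero _).2 hc
  have h2 := hilbertSymbol_eq_neg_one_iff_of_isUnramifiedIn ℚ v (E := k) (by rw [sq]; exact hθ) hθQ hunr hc'
  rw [h1, ← hilbertSymbol_ne_neg_one_iff, Ne, h2, log_valued_algebraMap v hc, hgen, not_and, Int.not_odd_iff_even]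
  exact ⟨fun h => by simpa using h hnsq, fun h _ => by simpa using h⟩

/-- **At an inert `p`: `p ∈ Diff(T, V) ⟺ ord_p(det T · det V)` is odd**, for `T`, `J` with rational determinants `d_T`,
`d_J ≠ 0` — (9.2) read through `χ_p = (−1)^{ord_p}` (O'Meara 63:16). [cite: KudlaRapoport2013, §9 (9.2) (arXiv v2 p. 33)]
[cite: Omeara1963, §63C Example 63:16] -/
theorem mem_diff_iff_odd_padicValRat {p : ℕ} [hp : Fact p.Prime] (hin : IsInertPrime k p)
    {n : ℕ} {T J : Matrix (Fin n) (Fin n) k} {dT dJ : ℚ}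
    (hdT : algebraMap ℚ k dT = T.det) (hdJ : algebraMap ℚ k dJ = J.det) (hdT0 : dT ≠ 0) (hdJ0 : dJ ≠ 0) :
    p ∈ diff k T J ↔ Odd (padicValRat p (dT * dJ)) := by
  have hiff : p ∈ diff k T J ↔ ¬ (IsLocalNormAt k p dT ↔ IsLocalNormAt k p dJ) := by
    constructor
    · rintro ⟨_, h⟩
      exact h dT dJ hdT hdJ
    · intro h
      refine ⟨hp, fun dT' dJ' h1 h2 => ?_⟩
      obtain rfl : dT' = dT := (algebraMap ℚ k).injective (h1.trans hdT.symm)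
      obtain rfl : dJ' = dJ := (algebraMap ℚ k).injective (h2.trans hdJ.symm)
      exact h
  rw [hiff, isLocalNormAt_iff_even_padicValRat k hin hdT0, isLocalNormAt_iff_even_padicValRat k hin hdJ0,
    padicValRat.mul hdT0 hdJ0, Int.odd_add, ← Int.not_even_iff_odd]
  tauto

end Literature.AlgebraicGeometry.ShimuraVarieties.KudlaRapoport2013.Sec7to10EisensteinSide
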